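import Summits.ResolutionOfSingularities.ResolutionOfSingularities.Theorems.HilbertSamuelEliminationCampaignW42HypersurfaceSectionRidge
import HarnessLib

/-!
# [OURS · L1 W4.2] Several hypersurface sections in the equality case cost at most that many DIRECTRIX dimensions over ANY
# field: `H⁽ʳ⁾(A/(t_1, …, t_r)) = H⁽⁰⁾(A) ⟹ e(A)_K ≤ e(A/(t))_K + r` (campaign s42, cell res-hironaka; informal crux
# `RidgeConfinement`, stmt-ResolutionOfSingularities-17845; `--supports`; brick D1 of the directrix form of CJS Thm. 3.10 (4))

HONEST FRAMING. OURS (slot W4.2, prover res-L1-s42-pv-1, gen 6). [OURS · L1 W4.2] replaces the role of nothing printed: it is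
the bookkeeping step «all intermediate sections are equality cases» of B. Dietel's (8.2.7.1), run for the directrix dimension
`e(·)_K` over an ARBITRARY common extension field `K` of the residue fields instead of Giraud's ridge (the tree's
`localRidgeDim_le_localRidgeDim_add_of_hilbertSamuelFun_eq`, gen 5, is the case `K` perfect). One section is the tree's
`dirDimOver_le_dirDimOver_add_one_of_hilbertSamuelFun_one_eq` (Dietel (4.6.5) (ii) + (6.4.6)); here:

* `dirDimOver_eq_of_ker_eq_bot` — zero kernel: `e(A)_K = e(B)_K`;
* **`dirDimOver_le_dirDimOver_add_of_hilbertSamuelFun_eq`** — for a surjection of noetherian local rings `A → B` with kernel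
  `(t_1, …, t_r)` and `H⁽ʳ⁾(B) = H⁽⁰⁾(A)`, and every field `K` over both residue fields compatibly: `e(A)_K ≤ e(B)_K + r`.

NOT a statement of H. Hironaka's manuscript [Hironaka2017]. AI review is weaker than expert review. References (orientation
only): B. Dietel, Dissertation Regensburg (2015), Prop. (4.6.5) (ii) p. 58, Lemma (6.4.6) p. 81, (8.2.7.1) p. 105–106;
V. Cossart, U. Jannsen, S. Saito, LNM 2270 (2020), Thm. 3.10 (4).
-/

noncomputable section

-- single-conjunct summit: the doubled namespace component `ResolutionOfSingularities` is mandated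
set_option linter.dupNamespace false

open IsLocalRing MvPolynomial Finset
open Literature.RingTheory.HilbertSamuel Literature.RingTheory.MvPolynomial
open Literature.AlgebraicGeometry.Resolution

namespace Summit.ResolutionOfSingularities.ResolutionOfSingularities.Theorems

namespace CampaignW42

universe u w

/-! ## Zero kernel -/

/-- `e(A)_K = e(B)_K` for a surjection with zero kernel (an isomorphism of local rings) and compatible `K`. [folklore] -/
theorem dirDimOver_eq_of_ker_eq_bot {A : Type u} {B : Type u} [CommRing A] [CommRing B] [IsLocalRing A] [IsLocalRing B]
    [IsNoetherianRing A] [IsNoetherianRing B] [Algebra A B] (hf : Function.Surjective (algebraMap A B))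
    (hK : RingHom.ker (algebraMap A B) = ⊥) (K : Type w) [Field K] [Algebra (ResidueField A) K]
    [Algebra (ResidueField B) K]
    (hKc : ∀ a : A, algebraMap (ResidueField B) K (residue B (algebraMap A B a)) =
      algebraMap (ResidueField A) K (residue A a)) :
    dirDimOver A K = dirDimOver B K := by
  let e : A ≃+* B := RingEquiv.ofBijective (algebraMap A B) ⟨(RingHom.injective_iff_ker_eq_bot _).mpr hK, hf⟩
  refine (dirDimOver_eq_of_ringEquiv e K ?_).symm
  refine RingHom.ext fun x => ?_
  obtain ⟨a, rfl⟩ := residue_surjective x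
  rw [RingHom.comp_apply, ResidueField.map_residue]
  exact hKc a

/-! ## Several sections -/

/-- Pointwise squeeze for chains of Hilbert functions: `a ≤ b ≤ c ≤ a ⟹ a = b ∧ b = c`. [folklore] -/
private theorem eq_of_le_chain' {a b c : ℕ → ℕ} (h1 : a ≤ b) (h2 : b ≤ c) (h3 : c ≤ a) : a = b ∧ b = c :=
  ⟨le_antisymm h1 (h2.trans h3), le_antisymm h2 (h3.trans h1)⟩

/-- Induction on the number of generators, through `A → A/t₁A → B`: every section on the way is an equality case, and the
field `K` is carried along `k_A ≅ k_{A/t₁A} ≅ k_B → K`. [cite: Dietel2015, (8.2.7.1) p. 105–106] -/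
private theorem dirDimOver_le_of_card_le (K : Type w) [Field K] (r : ℕ) :
    ∀ {A : Type u} {B : Type u} [CommRing A] [CommRing B] [IsLocalRing A] [IsLocalRing B] [IsNoetherianRing A]
      [IsNoetherianRing B] [Algebra A B] [Algebra (ResidueField A) K] [Algebra (ResidueField B) K],
      Function.Surjective (algebraMap A B) →
      (∀ a : A, algebraMap (ResidueField B) K (residue B (algebraMap A B a)) =
        algebraMap (ResidueField A) K (residue A a)) →
      ∀ s : Finset A, s.card ≤ r → RingHom.ker (algebraMap A B) = Ideal.span (s : Set A) →
        hilbertSamuelFun B s.card = hilbertFun A → dirDimOver A K ≤ dirDimOver B K + s.card := by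
  induction r with
  | zero =>
    intro A B _ _ _ _ _ _ _ _ _ hf hKc s hs hK _
    have hs0 : s = ∅ := Finset.card_eq_zero.mp (Nat.le_zero.mp hs)
    subst hs0
    rw [Finset.coe_empty, Ideal.span_empty] at hK
    rw [Finset.card_empty, add_zero, dirDimOver_eq_of_ker_eq_bot hf hK K hKc]
  | succ r ih =>
    intro A B _ _ _ _ _ _ _ _ _ hf hKc s hs hK hH
    classical
    by_cases hs0 : s = ∅
    · subst hs0
      rw [Finset.coe_empty, Ideal.span_empty] at hK
      rw [Finset.card_empty, add_zero, dirDimOver_eq_of_ker_eq_bot hf hK K hKc]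
    obtain ⟨a, ha⟩ := Finset.nonempty_iff_ne_empty.mpr hs0
    haveI : IsNoetherianRing (A ⧸ Ideal.span {a}) :=
      isNoetherianRing_of_surjective_algebraMap (A := A) (B := A ⧸ Ideal.span {a}) Ideal.Quotient.mk_surjective
    have haK : a ∈ RingHom.ker (algebraMap A B) := by rw [hK]; exact Ideal.subset_span (Finset.mem_coe.mpr ha)
    have haM : a ∈ maximalIdeal A := IsLocalRing.le_maximalIdeal (RingHom.ker_ne_top _) haK
    have hle : Ideal.span {a} ≤ RingHom.ker (algebraMap A B) := (Ideal.span_singleton_le_iff_mem _).mpr haK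
    have hne : Ideal.span {a} ≠ ⊤ := fun h => RingHom.ker_ne_top (algebraMap A B) (top_le_iff.mp (h ▸ hle))
    haveI : Nontrivial (A ⧸ Ideal.span {a}) := Ideal.Quotient.nontrivial_iff.mpr hne
    haveI : IsLocalRing (A ⧸ Ideal.span {a}) := IsLocalRing.of_surjective' _ Ideal.Quotient.mk_surjective
    -- the remaining surjection `A/aA → B`
    let g : A ⧸ Ideal.span {a} →+* B := Ideal.Quotient.lift (Ideal.span {a}) (algebraMap A B) hle
    letI : Algebra (A ⧸ Ideal.span {a}) B := g.toAlgebra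
    have hg : Function.Surjective (algebraMap (A ⧸ Ideal.span {a}) B) := by
      intro b
      obtain ⟨x, rfl⟩ := hf b
      exact ⟨Ideal.Quotient.mk _ x, Ideal.Quotient.lift_mk _ _ _⟩
    haveI hgloc : IsLocalHom (algebraMap (A ⧸ Ideal.span {a}) B) :=
      isLocalHom_of_map_maximalIdeal_eq (Literature.RingTheory.HilbertSamuel.map_maximalIdeal_eq_of_surjective hg)
    -- the field `K` over `k_{A/aA}`, through `A/aA → B`
    letI algQ : Algebra (ResidueField (A ⧸ Ideal.span {a})) K :=
      ((algebraMap (ResidueField B) K).comp (ResidueField.map (algebraMap (A ⧸ Ideal.span {a}) B))).toAlgebra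
    have hKcQB : ∀ q : A ⧸ Ideal.span {a}, algebraMap (ResidueField B) K (residue B (algebraMap (A ⧸ Ideal.span {a}) B q)) =
        algebraMap (ResidueField (A ⧸ Ideal.span {a})) K (residue (A ⧸ Ideal.span {a}) q) := fun q => by
      show algebraMap (ResidueField B) K (residue B (g q)) =
        (algebraMap (ResidueField B) K).comp (ResidueField.map (algebraMap (A ⧸ Ideal.span {a}) B)) (residue _ q)
      rw [RingHom.comp_apply, ResidueField.map_residue]
      rfl
    have hKcAQ : ∀ x : A, algebraMap (ResidueField (A ⧸ Ideal.span {a})) K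
        (residue (A ⧸ Ideal.span {a}) (algebraMap A (A ⧸ Ideal.span {a}) x)) = algebraMap (ResidueField A) K (residue A x) :=
      fun x => by
      rw [← hKcQB, ← hKc x]
      congr 2
    set s' : Finset (A ⧸ Ideal.span {a}) := (s.erase a).image (Ideal.Quotient.mk (Ideal.span {a})) with hs'_def
    have hs'le : s'.card + 1 ≤ s.card := by
      have h1 : s'.card ≤ (s.erase a).card := Finset.card_image_le
      rw [Finset.card_erase_of_mem ha] at h1
      have h2 := Finset.card_pos.mpr ⟨a, ha⟩
      omega
    have hs' : s'.card ≤ r := by omega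
    have hs_eq : (s : Set A) = insert a ((s.erase a : Finset A) : Set A) := by
      rw [← Finset.coe_insert, Finset.insert_erase ha]
    have hK' : RingHom.ker (algebraMap (A ⧸ Ideal.span {a}) B) = Ideal.span (s' : Set _) := by
      change RingHom.ker g = _
      rw [Ideal.ker_quotient_lift _ hle, hK, Ideal.map_span, hs_eq, Set.image_insert_eq,
        Ideal.Quotient.eq_zero_iff_mem.mpr (Ideal.mem_span_singleton_self a), hs'_def, Finset.coe_image]
      exact Submodule.span_insert_zero
    have hKa : RingHom.ker (algebraMap A (A ⧸ Ideal.span {a})) = Ideal.span {a} := by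
      rw [Ideal.Quotient.algebraMap_eq, Ideal.mk_ker]
    -- the chain `H(A) ≤ H⁽¹⁾(A/aA) ≤ H⁽¹⁺|s'|⁾(B) ≤ H⁽|s|⁾(B) = H(A)`
    have h1 : hilbertFun A ≤ hilbertSamuelFun (A ⧸ Ideal.span {a}) 1 :=
      hilbertFun_le_hilbertSamuelFun_one_of_ker_le (A := A) (B := A ⧸ Ideal.span {a}) Ideal.Quotient.mk_surjective haM hKa.le
    have h2 : hilbertSamuelFun (A ⧸ Ideal.span {a}) 1 ≤ hilbertSamuelFun B (1 + s'.card) :=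
      hilbertSamuelFun_le_of_ker_eq_span hg s' hK' 1
    have h3 : hilbertSamuelFun B (1 + s'.card) ≤ hilbertFun A := by
      rw [← hH]
      exact iterPSum_mono_left (hilbertFun B) (by omega)
    obtain ⟨hE1, hE2⟩ := eq_of_le_chain' h1 h2 h3
    -- one section: `e(A)_K ≤ e(A/aA)_K + 1`
    have hstep : dirDimOver A K ≤ dirDimOver (A ⧸ Ideal.span {a}) K + 1 := by
      haveI : IsLocalHom (algebraMap A (A ⧸ Ideal.span {a})) :=
        isLocalHom_of_map_maximalIdeal_eq
          (Literature.RingTheory.HilbertSamuel.map_maximalIdeal_eq_of_surjective Ideal.Quotient.mk_surjective)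
      refine dirDimOver_le_dirDimOver_add_one_of_hilbertSamuelFun_one_eq (A := A) (B := A ⧸ Ideal.span {a})
        Ideal.Quotient.mk_surjective hKa hE1.symm K ?_
      refine RingHom.ext fun x => ?_
      obtain ⟨y, rfl⟩ := residue_surjective x
      rw [RingHom.comp_apply, ResidueField.map_residue]
      exact hKcAQ y
    -- the rest: `H⁽|s'|⁾(B) = H⁽⁰⁾(A/aA)` and induction
    have hH' : hilbertSamuelFun B s'.card = hilbertFun (A ⧸ Ideal.span {a}) := by
      have h := hE2.symm
      rw [← iterPSum_hilbertSamuelFun B 1 s'.card] at h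
      change iterPSum 1 (hilbertSamuelFun B s'.card) = iterPSum 1 (hilbertFun (A ⧸ Ideal.span {a})) at h
      exact iterPSum_injective 1 h
    have hrest := ih hg hKcQB s' hs' hK' hH'
    omega

/-- **`e(A)_K ≤ e(B)_K + r` when `ker(A → B) = (t_1, …, t_r)` (`r = |s|`) and `H⁽ʳ⁾(B) = H⁽⁰⁾(A)`**, for every field `K` over
both residue fields compatibly — the iterated equality case: all `r` sections are then equality cases (the tree's inequalities
`H⁽ⁱ⁾ ≤ H⁽ⁱ⁺¹⁾` along `A → A/t₁ → ⋯ → B` squeeze), and each costs at most one directrix dimension over `K`.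
[cite: Dietel2015, (8.2.7.1)–(8.2.7.E) p. 105–106] [cite: CossartJannsenSaito2020, Thm. 3.10 (4)] -/
theorem dirDimOver_le_dirDimOver_add_card_of_hilbertSamuelFun_eq {A : Type u} {B : Type u} [CommRing A] [CommRing B]
    [IsLocalRing A] [IsLocalRing B] [IsNoetherianRing A] [IsNoetherianRing B] [Algebra A B]
    (hf : Function.Surjective (algebraMap A B)) (s : Finset A) (hK : RingHom.ker (algebraMap A B) = Ideal.span (s : Set A))
    (hH : hilbertSamuelFun B s.card = hilbertFun A) (K : Type w) [Field K] [Algebra (ResidueField A) K]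
    [Algebra (ResidueField B) K]
    (hKc : ∀ a : A, algebraMap (ResidueField B) K (residue B (algebraMap A B a)) =
      algebraMap (ResidueField A) K (residue A a)) :
    dirDimOver A K ≤ dirDimOver B K + s.card :=
  dirDimOver_le_of_card_le K s.card hf hKc s le_rfl hK hH

/-- **`e(A)_K ≤ e(B)_K + r` for a family `t : Fin r → A` generating the kernel with `H⁽ʳ⁾(B) = H⁽⁰⁾(A)`**, every field `K` over
both residue fields compatibly. [cite: Dietel2015, (8.2.7.1)–(8.2.7.E) p. 105–106] [cite: CossartJannsenSaito2020, Thm. 3.10 (4)] -/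
theorem dirDimOver_le_dirDimOver_add_of_hilbertSamuelFun_eq {A : Type u} {B : Type u} [CommRing A] [CommRing B]
    [IsLocalRing A] [IsLocalRing B] [IsNoetherianRing A] [IsNoetherianRing B] [Algebra A B]
    (hf : Function.Surjective (algebraMap A B)) {r : ℕ} (t : Fin r → A)
    (hK : RingHom.ker (algebraMap A B) = Ideal.span (Set.range t)) (hH : hilbertSamuelFun B r = hilbertFun A)
    (K : Type w) [Field K] [Algebra (ResidueField A) K] [Algebra (ResidueField B) K]
    (hKc : ∀ a : A, algebraMap (ResidueField B) K (residue B (algebraMap A B a)) =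
      algebraMap (ResidueField A) K (residue A a)) :
    dirDimOver A K ≤ dirDimOver B K + r := by
  classical
  have hcoe : ((Finset.univ.image t : Finset A) : Set A) = Set.range t := by
    rw [Finset.coe_image, Finset.coe_univ, Set.image_univ]
  have hcard : (Finset.univ.image t).card ≤ r :=
    Finset.card_image_le.trans (by rw [Finset.card_univ, Fintype.card_fin])
  -- `H⁽⁰⁾(A) ≤ H⁽|s|⁾(B) ≤ H⁽ʳ⁾(B) = H⁽⁰⁾(A)`
  have h1 : hilbertFun A ≤ hilbertSamuelFun B (Finset.univ.image t).card := by
    have := hilbertSamuelFun_le_of_ker_eq_span hf (Finset.univ.image t) (hcoe ▸ hK) 0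
    rwa [zero_add] at this
  have h2 : hilbertSamuelFun B (Finset.univ.image t).card ≤ hilbertSamuelFun B r := iterPSum_mono_left (hilbertFun B) hcard
  have hH' : hilbertSamuelFun B (Finset.univ.image t).card = hilbertFun A := le_antisymm (hH ▸ h2) h1
  exact (dirDimOver_le_dirDimOver_add_card_of_hilbertSamuelFun_eq hf _ (hcoe ▸ hK) hH' K hKc).trans (by omega)

end CampaignW42

end Summit.ResolutionOfSingularities.ResolutionOfSingularities.Theorems

end
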